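import Literature.NumberTheory.EllipticCurves.ModularSymbolsHeckeProofs
import HarnessLib

set_option autoImplicit false

/-!
# Crux `PrintCFram.BottomClassIndexLawFiveLe` (stmt-BirchSwinnertonDyer-20372), line `eisenstein-resource-bdp-line` (registry v28):
# T8 «THE LOWER-UNIPOTENT RUNG» (Raum 2023 Prop. 2.3 in the kernel), piece T8-2/3 file 1/2 — THE SLASH COMPUTATION AT A LOWER UNIPOTENT
# (cell `bsd-print-cfram`, width seat `bsd-line-cfram-p1-w5` g8; THEOREMS ONLY, `--supports` 20372; BSD is not proved by any of this)

HONEST FRAMING. Pure bookkeeping about functions on `ℍ`, slash operators and `q`-series; nothing here is a statement about elliptic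
curves, Bernoulli numbers or BSD; no registered stub is closed. This is the lower-unipotent twin of T3 (`…FlipRungSlash`, w4 g19):
Raum's device [Raum 2023, proof of Prop. 2.3, arXiv:2105.13170 pp. 22–24] read on the integral-weight vehicle of the typing wave
(crux notes w3g19 §2 (U1)–(U2); w2 g15 08:41Z). Setting: `F₀ : ℍ → ℂ` of weight `k`, invariant under every `γ' ∈ SL₂(ℤ)` with
`Mq² ∣ γ'₁₀`, `M ∣ γ'₁₁ − 1` (T3's binder verbatim); ANY weights `h : ℤ/q² → ℂ`; the twisted form `V(z) = q⁻² Σ_j h(j) F₀(z + j/q²)`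
(T3's `hV` verbatim); an integer `C` with `M ∣ C` and THE LOWER UNIPOTENT `γ = [1 0; q²C 1]` (no unit hypothesis on `C` is needed here).

* §1 THE MATRIX CORE (U1): for `j` with `q ∤ 1 + jC` and integers `h', e` with `(1 + jC)·h' = j + q²·e`, the matrix
  `δ_j = [1 + jC, −e; q²C, 1 − C·h']` has determinant `1`, `Mq² ∣ δ₁₀`, `M ∣ δ₁₁ − 1`, and `δ_j • (z + h'/q²) = γ • z + j/q²` with
  `denom = q²Cz + 1 = denom γ z` — the automorphy factors cancel EXACTLY (no power of `q`, no dilation: simpler than the flipped cusp).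
* §2 (A') THE DECOMPOSITION `(V ∣_k γ)(z) = q⁻² Σ_{q ∤ 1+jC} h(j) F₀(z + h'(j)/q²) + q⁻² Σ_{q ∣ 1+jC} h(j) (F₀ ∣_k (τ(j/q²)·γ))(z)`.
* §3 (B') THE MAIN TERM AS A q-SERIES in `e(z)`: coefficients `c₀(n)·S'(n)`, **`S'(n) = Σ_{q ∤ 1+jC} h(j) e(n·h'(j)/q²)`** (T8-1 evaluates
  `S'`: a Kloosterman sum at `n = qu`, `0` for `q ∤ n`).
* §4 (C') THE BAD TRANSLATES ARE `(1/q²)`-PERIODIC: for `q ∣ 1 + jC`, `(F₀ ∣_k (τ(j/q²)·γ)) ∣_k τ(1/q²) = F₀ ∣_k (τ(j/q²)·γ)` — because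
  `ρ = (τ(j/q²)γ)·τ(1/q²)·(τ(j/q²)γ)⁻¹ = [1 − C(1+jC), ((1+jC)/q)²; −q²C², 1 + C(1+jC)]` is INTEGRAL exactly when `q ∣ 1 + jC` and lies in
  `Γ₀(Mq²) ⊓ Γ₁(M)` (Raum: «their contributions later in the proof will vanish»).
* §5 the two existence lemmas (the lower unipotent in `SL₂(ℤ)`; the solutions `h', e` at the good translates, `q` prime).
The coefficient corollary (D') — the coefficient of `e(q·u·z)`, `q ∤ u`, in `V ∣_k γ` is `q⁻²·c₀(qu)·S'(qu)` — is the sequel file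
`…FlipRungLowerSlashCoeff`. beyond-print theorem: NO.

References: [Raum 2023] M. Raum, Relations among Ramanujan-type congruences II, Forum Math. 35 (2023) 615–646 = arXiv:2105.13170,
proof of Prop. 2.3; [Shimura1971] Prop. 3.64; [DiamondShurman2005] §1.2; crux notes w3g19 §2, lead-g14 §2.
-/

-- summit-side namespace `Summit.BirchSwinnertonDyer.BirchSwinnertonDyer.…` (single-conjunct summit, D-0017 layout)
set_option linter.dupNamespace false

noncomputable section

open scoped MatrixGroups ModularForm Real Classical Topology
open UpperHalfPlane hiding I
open Complex Matrix.GeneralLinearGroup CongruenceSubgroup Function Filter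
open Literature.NumberTheory.EllipticCurves.ModularForms (slash_upperRightHom_apply upperRightHom_smul qParam_vadd)

namespace Summit.BirchSwinnertonDyer.BirchSwinnertonDyer.Theorems.PrintCFram.FlipRung

/-! ## §1 The matrix core: `τ(j/q²)·γ = δ_j·τ(h'/q²)` read on `ℍ` -/

/-- **Determinant of `δ_j`.** If `(1 + jC)·h' = j + q²·e` then `det [1 + jC, −e; q²C, 1 − C·h'] = 1`. [folklore] -/
theorem det_deltaLower_eq_one {q C j h' e : ℤ} (hhe : (1 + j * C) * h' = j + q ^ 2 * e) :
    Matrix.det !![1 + j * C, -e; q ^ 2 * C, 1 - C * h'] = 1 := by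
  rw [Matrix.det_fin_two_of]
  linear_combination (-C) * hhe

/-- **The Möbius identity behind the lower unipotent** (as complex numbers). With `(1 + jC)·h' = j + q²·e`, `q ≠ 0` and
`q²Cz + 1 ≠ 0`: `δ_j` applied to `z + h'/q²` is `z/(q²Cz + 1) + j/q²`, and its denominator there is `q²Cz + 1`.
[cite: DiamondShurman2005, §1.2] -/
theorem deltaLower_moebius_eq {q C j h' e z : ℂ} (hq : q ≠ 0) (hhe : (1 + j * C) * h' = j + q ^ 2 * e)
    (hz : q ^ 2 * C * z + 1 ≠ 0) :
    ((1 + j * C) * (z + h' / q ^ 2) + (-e)) / ((q ^ 2 * C) * (z + h' / q ^ 2) + (1 - C * h')) =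
      z / (q ^ 2 * C * z + 1) + j / q ^ 2 ∧
    (q ^ 2 * C) * (z + h' / q ^ 2) + (1 - C * h') = q ^ 2 * C * z + 1 := by
  have hq2 : q ^ 2 ≠ 0 := pow_ne_zero 2 hq
  have hden : (q ^ 2 * C) * (z + h' / q ^ 2) + (1 - C * h') = q ^ 2 * C * z + 1 := by
    field_simp
    ring
  refine ⟨?_, hden⟩
  have hnum : (1 + j * C) * (z + h' / q ^ 2) + (-e) = ((1 + j * C) * z * q ^ 2 + j) / q ^ 2 := by
    have he : e = ((1 + j * C) * h' - j) / q ^ 2 := by rw [hhe]; field_simp; ring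
    rw [he]
    field_simp
    ring
  rw [hnum, hden, div_div, div_add_div _ _ hz hq2, div_eq_div_iff (mul_ne_zero hq2 hz) (mul_ne_zero hz hq2)]
  ring

/-- **The lower-unipotent factorisation read on `ℍ`.** Let `γ = [1 0; q²C 1] ∈ SL₂(ℤ)`, `q ≥ 1`, and `δ ∈ SL₂(ℤ)` the matrix
`[1 + jC, −e; q²C, 1 − C·h']` for integers with `(1 + jC)·h' = j + q²·e`. Then for every `z ∈ ℍ`:
`δ • (z + h'/q²) = γ • z + j/q²` and `denom δ (z + h'/q²) = q²Cz + 1` — i.e. `τ(j/q²)·γ = δ·τ(h'/q²)` with EQUAL automorphy factors.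
[cite: DiamondShurman2005, §1.2] -/
theorem deltaLower_smul_eq (γ δ : SL(2, ℤ)) {q : ℕ} (hq : q ≠ 0) {C j h' e : ℤ}
    (h00 : γ 0 0 = 1) (h01 : γ 0 1 = 0) (h10 : γ 1 0 = (q : ℤ) ^ 2 * C) (h11 : γ 1 1 = 1)
    (d00 : δ 0 0 = 1 + j * C) (d01 : δ 0 1 = -e) (d10 : δ 1 0 = (q : ℤ) ^ 2 * C) (d11 : δ 1 1 = 1 - C * h')
    (hhe : (1 + j * C) * h' = j + (q : ℤ) ^ 2 * e) (z : ℍ) :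
    δ • (((h' : ℝ) / (q : ℝ) ^ 2) +ᵥ z) = ((j : ℝ) / (q : ℝ) ^ 2) +ᵥ (γ • z) ∧
    denom δ (((h' : ℝ) / (q : ℝ) ^ 2) +ᵥ z) = (q : ℂ) ^ 2 * C * z + 1 := by
  have hqC : (q : ℂ) ≠ 0 := by exact_mod_cast hq
  have hheC : (1 + (j : ℂ) * C) * h' = j + (q : ℂ) ^ 2 * e := by exact_mod_cast hhe
  have hzden : (q : ℂ) ^ 2 * C * z + 1 ≠ 0 := by
    have h := denom_ne_zero γ z
    rw [ModularGroup.denom_apply, h10, h11] at h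
    simpa using h
  obtain ⟨hmob, hden⟩ := deltaLower_moebius_eq (C := (C : ℂ)) (j := (j : ℂ)) (h' := (h' : ℂ)) (e := (e : ℂ))
    (z := (z : ℂ)) hqC hheC hzden
  -- the point `z + h'/q²` as a complex number
  have hpt : ((((h' : ℝ) / (q : ℝ) ^ 2) +ᵥ z : ℍ) : ℂ) = (z : ℂ) + (h' : ℂ) / (q : ℂ) ^ 2 := by
    rw [coe_vadd]
    push_cast
    ring
  -- `γ • z` as a complex number
  have hγz : ((γ • z : ℍ) : ℂ) = (z : ℂ) / ((q : ℂ) ^ 2 * C * z + 1) := by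
    rw [coe_specialLinearGroup_apply]
    simp only [h00, h01, h10, h11, eq_intCast, Int.cast_one, Int.cast_zero, Int.cast_mul, Int.cast_pow, Int.cast_natCast]
    push_cast
    ring
  constructor
  · apply UpperHalfPlane.ext
    rw [coe_vadd, coe_specialLinearGroup_apply, hγz, hpt]
    simp only [d00, d01, d10, d11, eq_intCast, Int.cast_add, Int.cast_mul, Int.cast_pow, Int.cast_sub, Int.cast_one,
      Int.cast_neg, Int.cast_natCast]
    push_cast
    rw [hmob]
    ring
  · rw [ModularGroup.denom_apply, hpt, d10, d11]
    push_cast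
    rw [← hden]

/-! ## §2 (A') The decomposition of `V ∣_k γ` into the good translates (main term) and the bad translates (junk) -/

/-- **(A') THE DECOMPOSITION AT A LOWER UNIPOTENT.** Let `q ≥ 1`, `γ = [1 0; q²C 1] ∈ SL₂(ℤ)` with `M ∣ C`, `F₀ : ℍ → ℂ` a weight-`k`
function invariant under every `γ' ∈ SL₂(ℤ)` with `Mq² ∣ γ'₁₀` and `M ∣ γ'₁₁ − 1` (the group `Γ₀(Mq²) ⊓ Γ₁(M)`), `h : ℤ/q² → ℂ` ANY
weights, `V(z) = q⁻² Σ_j h(j) F₀(z + j/q²)` the twisted form, and `h', e : ℤ/q² → ℤ` with `(1 + jC)·h'(j) = j + q²·e(j)` at every GOOD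
`j` (`q ∤ 1 + jC`). Then for every `z ∈ ℍ`:
`(V ∣_k γ)(z) = q⁻² Σ_{j good} h(j) F₀(z + h'(j)/q²) + q⁻² Σ_{j bad} h(j) (F₀ ∣_k (τ(j/q²)·γ))(z)`.
The good translates factor through `δ_j ∈ Γ₀(Mq²) ⊓ Γ₁(M)` (§1) and the automorphy of `F₀` (factors cancel exactly); the bad ones
are left as slashes (they are `(1/q²)`-periodic, §4). [cite: Shimura1971, Prop. 3.64] [cite: DiamondShurman2005, §1.2] -/
theorem slash_lowerUnipotent_decomposition {q : ℕ} [NeZero (q ^ 2)] (hq : q ≠ 0) (γ : SL(2, ℤ)) {M C : ℤ} (hMC : M ∣ C)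
    (h00 : γ 0 0 = 1) (h01 : γ 0 1 = 0) (h10 : γ 1 0 = (q : ℤ) ^ 2 * C) (h11 : γ 1 1 = 1)
    {k : ℤ} (F₀ : ℍ → ℂ)
    (hinv : ∀ γ' : SL(2, ℤ), M * (q : ℤ) ^ 2 ∣ γ' 1 0 → M ∣ γ' 1 1 - 1 → F₀ ∣[k] γ' = F₀)
    (h : ZMod (q ^ 2) → ℂ) (V : ℍ → ℂ)
    (hV : ∀ z : ℍ, V z = ((q : ℂ) ^ 2)⁻¹ * ∑ j : ZMod (q ^ 2), h j * F₀ (((j.val : ℝ) / (q : ℝ) ^ 2) +ᵥ z))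
    (h' e : ZMod (q ^ 2) → ℤ)
    (hhe : ∀ j : ZMod (q ^ 2), ¬ (q : ℤ) ∣ 1 + (j.val : ℤ) * C →
      (1 + (j.val : ℤ) * C) * h' j = (j.val : ℤ) + (q : ℤ) ^ 2 * e j)
    (z : ℍ) :
    (V ∣[k] γ) z =
      ((q : ℂ) ^ 2)⁻¹ *
          ∑ j ∈ Finset.univ.filter (fun j : ZMod (q ^ 2) ↦ ¬ (q : ℤ) ∣ 1 + (j.val : ℤ) * C),
            h j * F₀ (((h' j : ℝ) / (q : ℝ) ^ 2) +ᵥ z) +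
        ((q : ℂ) ^ 2)⁻¹ *
          ∑ j ∈ Finset.univ.filter (fun j : ZMod (q ^ 2) ↦ (q : ℤ) ∣ 1 + (j.val : ℤ) * C),
            h j * (F₀ ∣[k] (upperRightHom ((j.val : ℝ) / (q : ℝ) ^ 2) * (γ : GL (Fin 2) ℝ))) z := by
  obtain ⟨c', hc'⟩ := hMC
  -- `denom γ z = q²C z + 1 ≠ 0`
  have hden0 : denom γ z = (q : ℂ) ^ 2 * C * z + 1 := by
    rw [ModularGroup.denom_apply, h10, h11]; push_cast; ring
  have hzden : (q : ℂ) ^ 2 * C * z + 1 ≠ 0 := by rw [← hden0]; exact denom_ne_zero γ z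
  -- the good translates: factor through `δ_j` and use the automorphy of `F₀` (the factors cancel exactly)
  have hgood : ∀ j : ZMod (q ^ 2), ¬ (q : ℤ) ∣ 1 + (j.val : ℤ) * C →
      F₀ (((j.val : ℝ) / (q : ℝ) ^ 2) +ᵥ (γ • z)) * denom γ z ^ (-k) = F₀ (((h' j : ℝ) / (q : ℝ) ^ 2) +ᵥ z) := by
    intro j hj
    set zj : ℍ := ((h' j : ℝ) / (q : ℝ) ^ 2) +ᵥ z with hzj
    let δ : SL(2, ℤ) := ⟨!![1 + (j.val : ℤ) * C, -e j; (q : ℤ) ^ 2 * C, 1 - C * h' j],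
      det_deltaLower_eq_one (hhe j hj)⟩
    have d00 : δ 0 0 = 1 + (j.val : ℤ) * C := rfl
    have d01 : δ 0 1 = -e j := rfl
    have d10 : δ 1 0 = (q : ℤ) ^ 2 * C := rfl
    have d11 : δ 1 1 = 1 - C * h' j := rfl
    obtain ⟨hsmul, hdenj⟩ := deltaLower_smul_eq γ δ hq h00 h01 h10 h11 d00 d01 d10 d11 (hhe j hj) z
    rw [Int.cast_natCast] at hsmul
    -- automorphy of `F₀` under `δ ∈ Γ₀(Mq²) ⊓ Γ₁(M)`
    have hδ : F₀ ∣[k] δ = F₀ := by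
      refine hinv δ ?_ ?_
      · rw [d10, hc']; exact ⟨c', by ring⟩
      · rw [d11, hc']; exact ⟨-(c' * h' j), by ring⟩
    have hval := (ModularForm.slash_action_eq'_iff k F₀ δ zj).mp (congrFun hδ zj)
    have hdenj' : ((δ 1 0 : ℤ) : ℂ) * (zj : ℂ) + ((δ 1 1 : ℤ) : ℂ) = (q : ℂ) ^ 2 * C * z + 1 := by
      rw [← hdenj, ModularGroup.denom_apply]
    rw [← hsmul, hval, hdenj', hden0, zpow_neg, mul_comm (_ ^ k) (F₀ zj), mul_assoc,
      mul_inv_cancel₀ (zpow_ne_zero k hzden), mul_one]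
  -- the bad translates: just slashes
  have hnon : ∀ j : ZMod (q ^ 2),
      F₀ (((j.val : ℝ) / (q : ℝ) ^ 2) +ᵥ (γ • z)) * denom γ z ^ (-k) =
        (F₀ ∣[k] (upperRightHom ((j.val : ℝ) / (q : ℝ) ^ 2) * (γ : GL (Fin 2) ℝ))) z := by
    intro j
    rw [SlashAction.slash_mul, ← ModularForm.SL_slash, ModularForm.SL_slash_apply, slash_upperRightHom_apply]
  -- assemble
  rw [ModularForm.SL_slash_apply, hV, mul_assoc, Finset.sum_mul,
    ← Finset.sum_filter_add_sum_filter_not Finset.univ (fun j : ZMod (q ^ 2) ↦ (q : ℤ) ∣ 1 + (j.val : ℤ) * C),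
    mul_add, add_comm]
  congr 1
  · congr 1
    refine Finset.sum_congr rfl fun j hj ↦ ?_
    rw [Finset.mem_filter] at hj
    rw [mul_assoc, hgood j hj.2]
  · congr 1
    refine Finset.sum_congr rfl fun j _ ↦ ?_
    rw [mul_assoc, hnon j]

/-! ## §3 (B') The main term as a `q`-series in `e(z)` -/

/-- `e(z + y/q²) = e(y/q²)·e(z)`: the parameter `𝕢₁` at the translate `z + y/q²`. [folklore] -/
theorem qParam_one_translate (q : ℕ) (y : ℤ) (z : ℍ) :
    Periodic.qParam 1 ((((y : ℝ) / (q : ℝ) ^ 2) +ᵥ z : ℍ) : ℂ) =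
      cexp (2 * π * I * ((y : ℂ) / (q : ℂ) ^ 2)) * Periodic.qParam 1 (z : ℂ) := by
  rw [qParam_vadd]
  push_cast
  ring_nf

/-- **(B') THE MAIN TERM AS A q-SERIES.** If `F₀(τ) = Σ c₀(n) e(nτ)` on `ℍ`, then for any finite set `s` of translates, any weights `h`
and integers `h'(j)`: `Σ_{j ∈ s} h(j) F₀(z + h'(j)/q²) = Σ_n c₀(n)·S'(n)·e(nz)` with **`S'(n) = Σ_{j ∈ s} h(j) e(n·h'(j)/q²)`** — the finite
sum that T8-1 evaluates at the good translates (a Kloosterman sum at `n = qu`). [cite: Shimura1971, Prop. 3.64] -/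
theorem hasSum_translates_mainTerm {q : ℕ} (F₀ : ℍ → ℂ) (c₀ : ℕ → ℂ)
    (hF₀ : ∀ τ : ℍ, HasSum (fun n : ℕ ↦ c₀ n * Periodic.qParam 1 (τ : ℂ) ^ n) (F₀ τ))
    (s : Finset (ZMod (q ^ 2))) (h : ZMod (q ^ 2) → ℂ) (h' : ZMod (q ^ 2) → ℤ) (z : ℍ) :
    HasSum (fun n : ℕ ↦ c₀ n *
        (∑ j ∈ s, h j * cexp (2 * π * I * ((h' j : ℂ) / (q : ℂ) ^ 2) * n)) *
        Periodic.qParam 1 (z : ℂ) ^ n)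
      (∑ j ∈ s, h j * F₀ (((h' j : ℝ) / (q : ℝ) ^ 2) +ᵥ z)) := by
  have key : ∀ j ∈ s,
      HasSum (fun n : ℕ ↦ h j * (c₀ n * (cexp (2 * π * I * ((h' j : ℂ) / (q : ℂ) ^ 2) * n) *
          Periodic.qParam 1 (z : ℂ) ^ n)))
        (h j * F₀ (((h' j : ℝ) / (q : ℝ) ^ 2) +ᵥ z)) := by
    intro j _
    refine HasSum.mul_left (h j) ?_
    have hs := hF₀ (((h' j : ℝ) / (q : ℝ) ^ 2) +ᵥ z)
    refine hs.congr_fun fun n ↦ ?_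
    rw [qParam_one_translate q (h' j) z, mul_pow, ← Complex.exp_nat_mul]
    ring_nf
  refine (hasSum_sum key).congr_fun fun n ↦ ?_
  rw [Finset.mul_sum, Finset.sum_mul]
  exact Finset.sum_congr rfl fun j _ ↦ by ring

/-! ## §4 (C') The bad translates are `(1/q²)`-periodic -/

/-- **The conjugated translation at a bad translate.** For `γ = [1 0; q²C 1]`, an integer `j` with `1 + jC = q·s` and
`ρ = [1 − C(1+jC), s²; −q²C², 1 + C(1+jC)]`: `τ(j/q²) · γ · τ(1/q²) = ρ · τ(j/q²) · γ` in `GL₂(ℝ)`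
(`ρ = (τ(j/q²)γ)·τ(1/q²)·(τ(j/q²)γ)⁻¹`, integral because `q ∣ 1 + jC`). [cite: DiamondShurman2005, §1.2] -/
theorem translate_mul_lowerUnipotent_mul_translate_eq (γ ρ : SL(2, ℤ)) {q : ℕ} (hq : q ≠ 0) {C j s : ℤ}
    (hs : 1 + j * C = (q : ℤ) * s)
    (h00 : γ 0 0 = 1) (h01 : γ 0 1 = 0) (h10 : γ 1 0 = (q : ℤ) ^ 2 * C) (h11 : γ 1 1 = 1)
    (r00 : ρ 0 0 = 1 - C * (1 + j * C)) (r01 : ρ 0 1 = s ^ 2) (r10 : ρ 1 0 = -((q : ℤ) ^ 2 * C ^ 2))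
    (r11 : ρ 1 1 = 1 + C * (1 + j * C)) :
    upperRightHom ((j : ℝ) / (q : ℝ) ^ 2) * (γ : GL (Fin 2) ℝ) * upperRightHom (((q : ℝ) ^ 2)⁻¹) =
      (ρ : GL (Fin 2) ℝ) * (upperRightHom ((j : ℝ) / (q : ℝ) ^ 2) * (γ : GL (Fin 2) ℝ)) := by
  have hqR : (q : ℝ) ≠ 0 := by exact_mod_cast hq
  have hsR : 1 + (j : ℝ) * C = (q : ℝ) * s := by exact_mod_cast hs
  have h00R : ((γ 0 0 : ℤ) : ℝ) = 1 := by exact_mod_cast h00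
  have h01R : ((γ 0 1 : ℤ) : ℝ) = 0 := by exact_mod_cast h01
  have h10R : ((γ 1 0 : ℤ) : ℝ) = (q : ℝ) ^ 2 * C := by exact_mod_cast h10
  have h11R : ((γ 1 1 : ℤ) : ℝ) = 1 := by exact_mod_cast h11
  have r00R : ((ρ 0 0 : ℤ) : ℝ) = 1 - (C : ℝ) * (1 + j * C) := by exact_mod_cast r00
  have r01R : ((ρ 0 1 : ℤ) : ℝ) = (s : ℝ) ^ 2 := by exact_mod_cast r01
  have r10R : ((ρ 1 0 : ℤ) : ℝ) = -((q : ℝ) ^ 2 * (C : ℝ) ^ 2) := by exact_mod_cast r10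
  have r11R : ((ρ 1 1 : ℤ) : ℝ) = 1 + (C : ℝ) * (1 + j * C) := by exact_mod_cast r11
  refine Units.ext ?_
  ext i hi
  fin_cases i <;> fin_cases hi <;>
    simp [Matrix.mul_apply, Fin.sum_univ_two, upperRightHom, Matrix.vecMul, dotProduct, Matrix.map_apply,
      h00R, h01R, h10R, h11R, r00R, r01R, r10R, r11R] <;>
    field_simp
  · linear_combination ((C : ℝ) * (1 + (j : ℝ) * C + (q : ℝ) * s)) * hsR
  · linear_combination (1 + (j : ℝ) * C + (q : ℝ) * s) * hsR
  · ring
  · ring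

/-- **(C') THE BAD TRANSLATES ARE `(1/q²)`-PERIODIC.** For `γ = [1 0; q²C 1]` with `M ∣ C`, a weight-`k` function `F₀` invariant under
every `γ' ∈ SL₂(ℤ)` with `Mq² ∣ γ'₁₀`, `M ∣ γ'₁₁ − 1`, and an integer `j` with `q ∣ 1 + jC`:
`(F₀ ∣_k (τ(j/q²)·γ)) ∣_k τ(1/q²) = F₀ ∣_k (τ(j/q²)·γ)` — the matrix `ρ` of `translate_mul_lowerUnipotent_mul_translate_eq` has
lower-left entry `−q²C²` and diagonal `≡ 1 (mod C)`. So the junk of the decomposition (A') is a `(1/q²)`-periodic function of `z`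
(only frequencies `≡ 0 (mod q²)`). [cite: DiamondShurman2005, §1.2] -/
theorem slash_translate_lowerUnipotent_periodic (γ : SL(2, ℤ)) {q : ℕ} (hq : q ≠ 0) {M C : ℤ} (hMC : M ∣ C)
    (h00 : γ 0 0 = 1) (h01 : γ 0 1 = 0) (h10 : γ 1 0 = (q : ℤ) ^ 2 * C) (h11 : γ 1 1 = 1)
    {k : ℤ} (F₀ : ℍ → ℂ)
    (hinv : ∀ γ' : SL(2, ℤ), M * (q : ℤ) ^ 2 ∣ γ' 1 0 → M ∣ γ' 1 1 - 1 → F₀ ∣[k] γ' = F₀)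
    {j : ℤ} (hj : (q : ℤ) ∣ 1 + j * C) :
    (F₀ ∣[k] (upperRightHom ((j : ℝ) / (q : ℝ) ^ 2) * (γ : GL (Fin 2) ℝ))) ∣[k] upperRightHom (((q : ℝ) ^ 2)⁻¹) =
      F₀ ∣[k] (upperRightHom ((j : ℝ) / (q : ℝ) ^ 2) * (γ : GL (Fin 2) ℝ)) := by
  obtain ⟨s, hs⟩ := hj
  obtain ⟨c', hc'⟩ := hMC
  -- the conjugated translation `ρ`
  let ρ : SL(2, ℤ) := ⟨!![1 - C * (1 + j * C), s ^ 2; -((q : ℤ) ^ 2 * C ^ 2), 1 + C * (1 + j * C)], by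
    rw [Matrix.det_fin_two_of]
    linear_combination (-(C ^ 2) * (1 + j * C + (q : ℤ) * s)) * hs⟩
  have hρ : F₀ ∣[k] ρ = F₀ := by
    refine hinv ρ ⟨-(c' * C), ?_⟩ ⟨c' * (1 + j * C), ?_⟩
    · show -((q : ℤ) ^ 2 * C ^ 2) = M * (q : ℤ) ^ 2 * -(c' * C)
      rw [hc']; ring
    · show 1 + C * (1 + j * C) - 1 = M * (c' * (1 + j * C))
      rw [hc']; ring
  have hmat := translate_mul_lowerUnipotent_mul_translate_eq γ ρ hq hs h00 h01 h10 h11 rfl rfl rfl rfl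
  rw [← SlashAction.slash_mul, hmat, SlashAction.slash_mul, ← ModularForm.SL_slash, hρ]

/-- **(C') in the indexing of (A'):** for `j ∈ ℤ/q²` with `q ∣ 1 + j·C` (on the representative in `[0, q²)`), the translate slash
`F₀ ∣_k (τ(j/q²)·γ)` of the decomposition is `(1/q²)`-periodic. [cite: DiamondShurman2005, §1.2] -/
theorem slash_translate_lowerUnipotent_periodic_of_dvd {q : ℕ} [NeZero (q ^ 2)] (hq : q ≠ 0) (γ : SL(2, ℤ)) {M C : ℤ}
    (hMC : M ∣ C) (h00 : γ 0 0 = 1) (h01 : γ 0 1 = 0) (h10 : γ 1 0 = (q : ℤ) ^ 2 * C) (h11 : γ 1 1 = 1)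
    {k : ℤ} (F₀ : ℍ → ℂ)
    (hinv : ∀ γ' : SL(2, ℤ), M * (q : ℤ) ^ 2 ∣ γ' 1 0 → M ∣ γ' 1 1 - 1 → F₀ ∣[k] γ' = F₀)
    {j : ZMod (q ^ 2)} (hj : (q : ℤ) ∣ 1 + (j.val : ℤ) * C) :
    (F₀ ∣[k] (upperRightHom ((j.val : ℝ) / (q : ℝ) ^ 2) * (γ : GL (Fin 2) ℝ))) ∣[k] upperRightHom (((q : ℝ) ^ 2)⁻¹) =
      F₀ ∣[k] (upperRightHom ((j.val : ℝ) / (q : ℝ) ^ 2) * (γ : GL (Fin 2) ℝ)) := by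
  have h := slash_translate_lowerUnipotent_periodic γ hq hMC h00 h01 h10 h11 F₀ hinv (k := k) hj
  rwa [Int.cast_natCast] at h

/-! ## §5 Existence: the lower unipotent and the solutions at the good translates -/

/-- The lower unipotent `[1 0; q²C 1]` is an element of `SL₂(ℤ)`. [folklore] -/
theorem exists_lowerUnipotent (q : ℕ) (C : ℤ) :
    ∃ γ : SL(2, ℤ), γ 0 0 = 1 ∧ γ 0 1 = 0 ∧ γ 1 0 = (q : ℤ) ^ 2 * C ∧ γ 1 1 = 1 :=
  ⟨⟨!![1, 0; (q : ℤ) ^ 2 * C, 1], by rw [Matrix.det_fin_two_of]; ring⟩, rfl, rfl, rfl, rfl⟩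

/-- **Solutions at the good translates.** For a prime `q` and any `C`, there are `h', e : ℤ/q² → ℤ` with
`(1 + jC)·h'(j) = j + q²·e(j)` at every `j` with `q ∤ 1 + jC` (Bezout: `1 + jC` is prime to `q²`). [folklore] -/
theorem exists_goodTranslate_solutions {q : ℕ} (hq : q.Prime) (C : ℤ) :
    ∃ h' e : ZMod (q ^ 2) → ℤ, ∀ j : ZMod (q ^ 2), ¬ (q : ℤ) ∣ 1 + (j.val : ℤ) * C →
      (1 + (j.val : ℤ) * C) * h' j = (j.val : ℤ) + (q : ℤ) ^ 2 * e j := by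
  have key : ∀ j : ZMod (q ^ 2), ∃ y t : ℤ, ¬ (q : ℤ) ∣ 1 + (j.val : ℤ) * C →
      (1 + (j.val : ℤ) * C) * y = (j.val : ℤ) + (q : ℤ) ^ 2 * t := by
    intro j
    by_cases hj : (q : ℤ) ∣ 1 + (j.val : ℤ) * C
    · exact ⟨0, 0, fun hn ↦ (hn hj).elim⟩
    · have hirr : Irreducible (q : ℤ) := (Nat.prime_iff_prime_int.mp hq).irreducible
      have hcop : IsCoprime ((q : ℤ) ^ 2) (1 + (j.val : ℤ) * C) :=
        ((hirr.coprime_iff_not_dvd).mpr hj).pow_left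
      obtain ⟨a, b, hab⟩ := hcop
      exact ⟨b * (j.val : ℤ), -(a * (j.val : ℤ)), fun _ ↦ by linear_combination ((j.val : ℤ)) * hab⟩
  choose y t hyt using key
  exact ⟨y, t, hyt⟩

end Summit.BirchSwinnertonDyer.BirchSwinnertonDyer.Theorems.PrintCFram.FlipRung

end
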